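import Mathlib
import Summits.Ventures.HodgeRepro.Tier4.Common.HaarProductSetIntegral
import Summits.Ventures.HodgeRepro.Tier4.Common.HaarProductSetIntegralMul
import Summits.Ventures.HodgeRepro.Tier4.Line4.TorusProduct
import Summits.Ventures.HodgeRepro.Tier4.Line4.TorusProductHaar
import Summits.Ventures.HodgeRepro.Tier4.Line4.InnerSplit
import Summits.Ventures.HodgeRepro.Tier4.Line4.CentreFinDomain

/-!
# Tier4/Line4/ProdInt — C-L4-PRODINT: UNFOLD-Z's right-hand side factorises on the product domain

Blind re-derivation cell `pub-hodge-repro`, Tier 4 «prove the step» (README §9–§10), seat t4-typer-1 (gen 2), on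
plan-4 g3's word S14652 («C-L4-PRODINT IS YOURS»); statements VERBATIM from plan-4's Factorisation-STATEMENTS-v2
(777b21f7ec8bf57d, Part 4) with the rename `infT → infTInf` of S14617 (the name TorusProduct landed) and the idle binders
`_`-prefixed (`hDZf`, `hIinf`, `hIfin` — the identities need neither the measurability of `DZ_f` nor the finiteness of the
factors; they stay displayed for the consumer).  Tree path `lean/Summits/Ventures/HodgeRepro/Tier4/Line4/ProdInt.lean`.
Mathlib-level; no literature.

WHAT IS PROVED.  On the product domain `prodDomain W DZf = (torusSplit W).symm '' (univ ×ˢ DZf)` (L2-p2's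
`Line4.CentreFinDomain`, Part 3) with `μ_T = c (ν_∞ ⊗ ν_f)` transported through `torusSplit` (TorusProductHaar, Part 0):
* `setIntegral_prodDomain_eq` — the set integral over the product domain is `c` times the iterated integral with the inner
  integral over `DZ_f` (typer-1's generic `Common.setIntegral_image_symm_univ_prod` at `e := torusSplit W`);
* `chi_mul_innerFull_eq_of_prod` — for a product test function the integrand `χ(t) · innerFull F γ₀ t` is the product
  `[χ(t_∞) I_∞(t_∞)] · [c′ χ(t_f) I_f(t_f)]` (INNERSPLIT `innerFull_eq_mul_of_prod` + `chi_mul` on `t = t_∞ t_f`);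
* **`setIntegral_chi_innerFull_prodDomain_eq`** — `∫_{T_∞ × DZ_f} χ(t) innerFull F γ₀ t = (c c′) · (∫_{T_∞} χ I_∞) · (∫_{DZ_f} χ I_f)`
  (typer-1's generic `Common.setIntegral_image_symm_univ_prod_mul`, Fubini without integrability).

Nothing here says anything about the status of the Hodge conjecture for CM abelian varieties, which is NOT proved
(HC_CM is NOT proved by anyone in this repository).
-/

set_option autoImplicit false
noncomputable section
namespace Summit.Ventures.HodgeRepro.Tier4.Line4
open Summit.Ventures.HodgeRepro.Tier4 Summit.Ventures.HodgeRepro.Tier4.Common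
  Summit.Ventures.HodgeRepro.Tier4.Line1 MeasureTheory
open scoped ComplexConjugate Topology Pointwise NNReal

/-! ## Part 4 — C-L4-PRODINT -/

section ProdInt
variable {k : Type} [Field k] [NumberField k] (W : PlaneData k)
  [MeasurableSpace (torusT W)] [MeasurableSpace (torusT' W)] (R : RTFData W)

omit [MeasurableSpace (torusT' W)] in
/-- **The set integral over the product domain is the iterated integral** (`Measure.map` of a product restricted to
`univ ×ˢ DZ_f` is the product of `ν_∞` and `ν_f.restrict DZ_f`) — typer-1's generic
`Common.setIntegral_image_symm_univ_prod` at `e := torusSplit W` (`prodDomain W DZf = (torusSplit W).symm '' (univ ×ˢ DZf)`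
and `(torusSplit W).symm (a, b) = a * b` by definition); the measurability of `DZ_f` is not needed for the identity. -/
theorem setIntegral_prodDomain_eq [BorelSpace (torusT W)]
    (νinf : Measure (torusInf W)) [νinf.IsHaarMeasure] (νf : Measure (torusFin W)) [νf.IsHaarMeasure]
    (μT : Measure (torusT W)) (c : ℝ≥0) (hc : μT = c • Measure.map (torusSplit W).symm (νinf.prod νf))
    (DZf : Set (torusFin W)) (_hDZf : MeasurableSet DZf)
    (G : torusT W → ℂ) (hG : IntegrableOn G (prodDomain W DZf) μT) :
    ∫ t in prodDomain W DZf, G t ∂μT =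
      (c : ℝ) • ∫ a : torusInf W, ∫ b in DZf, G ((a : torusT W) * (b : torusT W)) ∂νf ∂νinf := by
  haveI := secondCountable_torusInf W
  haveI := secondCountable_torusFin W
  haveI := locallyCompact_torusInf W
  haveI := locallyCompact_torusFin W
  exact Summit.Ventures.HodgeRepro.Tier4.Common.setIntegral_image_symm_univ_prod (torusSplit W) μT νinf νf c hc
    DZf G hG

/-- The integrand `χ(t) · innerFull F γ₀ t` of PRODINT is a PRODUCT function along `torusSplit`: with
`(a, b) = (t_∞, t_f)`, it is `[χ(a) I_∞(a)] · [c′ χ(b) I_f(b)]` (INNERSPLIT for the inner integral, `chi_mul` for `χ`). -/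
theorem chi_mul_innerFull_eq_of_prod [BorelSpace (torusT' W)]
    (νinf' : Measure (torusInf' W)) [νinf'.IsHaarMeasure] (νf' : Measure (torusFin' W)) [νf'.IsHaarMeasure]
    (c' : ℝ≥0) (hc' : R.μT' = c' • Measure.map (torusSplit' W).symm (νinf'.prod νf'))
    (F Finf Ffin : GA W → ℂ) (hF : ∀ g, F g = Finf (GA.ofInfPart W g) * Ffin (GA.ofFinPart W g))
    (γ₀ : GA W)
    (hA : ∀ t : torusT W, Integrable (fun a : torusInf' W => conj (R.chi' (a : torusT' W)) *
      Finf ((GA.ofInfPart W t)⁻¹ * GA.ofInfPart W γ₀ * ((a : torusT' W) : GA W))) νinf')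
    (hB : ∀ t : torusT W, Integrable (fun b : torusFin' W => conj (R.chi' (b : torusT' W)) *
      Ffin ((GA.ofFinPart W t)⁻¹ * GA.ofFinPart W γ₀ * ((b : torusT' W) : GA W))) νf')
    (t : torusT W) :
    R.chi t * innerFull W R F γ₀ t =
      (R.chi (infTInf W t : torusT W) * innerInf W R Finf γ₀ νinf' (infTInf W t)) *
        ((c' : ℂ) * (R.chi (finTf W t : torusT W) * innerFin W R Ffin γ₀ νf' (finTf W t))) := by
  have ht : t = (infTInf W t : torusT W) * (finTf W t : torusT W) := ((torusSplit W).symm_apply_apply t).symm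
  have hchi : R.chi t = R.chi (infTInf W t : torusT W) * R.chi (finTf W t : torusT W) := by
    conv_lhs => rw [ht]
    exact R.chi_mul _ _
  rw [innerFull_eq_mul_of_prod W R νinf' νf' c' hc' F Finf Ffin hF γ₀ t (hA t) (hB t), hchi]
  ring

/-- **C-L4-PRODINT — UNFOLD-Z's right-hand side FACTORISES**: on the product domain, for a product test function and
product Haar measures on both tori,
`∫_{T_∞ × DZ_f} χ(t) innerFull F γ₀ t = (c c′) · (∫_{T_∞} χ(a) I_∞(a)) · (∫_{DZ_f} χ(b) I_f(b))`
(`χ(a b) = χ(a) χ(b)` is `chi_mul`; INNERSPLIT inside; Fubini) — typer-1's generic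
`Common.setIntegral_image_symm_univ_prod_mul` (no integrability needed for the identity: the binders `hIinf`, `hIfin` are
the finiteness the next consumer may want and are idle here). -/
theorem setIntegral_chi_innerFull_prodDomain_eq [BorelSpace (torusT W)] [BorelSpace (torusT' W)]
    (νinf : Measure (torusInf W)) [νinf.IsHaarMeasure] (νf : Measure (torusFin W)) [νf.IsHaarMeasure]
    (c : ℝ≥0) (hc : R.μT = c • Measure.map (torusSplit W).symm (νinf.prod νf))
    (νinf' : Measure (torusInf' W)) [νinf'.IsHaarMeasure] (νf' : Measure (torusFin' W)) [νf'.IsHaarMeasure]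
    (c' : ℝ≥0) (hc' : R.μT' = c' • Measure.map (torusSplit' W).symm (νinf'.prod νf'))
    (F Finf Ffin : GA W → ℂ) (hF : ∀ g, F g = Finf (GA.ofInfPart W g) * Ffin (GA.ofFinPart W g))
    (γ₀ : GA W) (DZf : Set (torusFin W)) (_hDZf : MeasurableSet DZf)
    (hA : ∀ t : torusT W, Integrable (fun a : torusInf' W => conj (R.chi' (a : torusT' W)) *
      Finf ((GA.ofInfPart W t)⁻¹ * GA.ofInfPart W γ₀ * ((a : torusT' W) : GA W))) νinf')
    (hB : ∀ t : torusT W, Integrable (fun b : torusFin' W => conj (R.chi' (b : torusT' W)) *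
      Ffin ((GA.ofFinPart W t)⁻¹ * GA.ofFinPart W γ₀ * ((b : torusT' W) : GA W))) νf')
    (_hIinf : Integrable (fun a : torusInf W => R.chi a * innerInf W R Finf γ₀ νinf' a) νinf)
    (_hIfin : IntegrableOn (fun b : torusFin W => R.chi b * innerFin W R Ffin γ₀ νf' b) DZf νf) :
    ∫ t in prodDomain W DZf, R.chi t * innerFull W R F γ₀ t ∂(R.μT) =
      ((c : ℂ) * (c' : ℂ)) * (∫ a : torusInf W, R.chi a * innerInf W R Finf γ₀ νinf' a ∂νinf) *
        (∫ b in DZf, R.chi b * innerFin W R Ffin γ₀ νf' b ∂νf) := by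
  haveI := secondCountable_torusInf W
  haveI := secondCountable_torusFin W
  haveI := locallyCompact_torusInf W
  haveI := locallyCompact_torusFin W
  unfold prodDomain
  rw [Summit.Ventures.HodgeRepro.Tier4.Common.setIntegral_image_symm_univ_prod_mul (torusSplit W) R.μT νinf νf c hc
    DZf (fun t => R.chi t * innerFull W R F γ₀ t)
    (fun a : torusInf W => R.chi a * innerInf W R Finf γ₀ νinf' a)
    (fun b : torusFin W => (c' : ℂ) * (R.chi b * innerFin W R Ffin γ₀ νf' b))
    (fun t => chi_mul_innerFull_eq_of_prod W R νinf' νf' c' hc' F Finf Ffin hF γ₀ hA hB t),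
    integral_const_mul, Complex.real_smul]
  ring

end ProdInt

end Summit.Ventures.HodgeRepro.Tier4.Line4
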